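import Mathlib

/-!
# Tail syzygies: the slot lemma of the row-`0` mixed class with GENERAL right generators

Support file for crux item `stmt-MatrixMultiplication-10752`
(`Summit.MatrixMultiplication.MatrixMultiplication.Theses.HiddenToeplitzCorners.HiddenCornerLemmaR`),
line `atkinson-lloyd-core-split`, stub `stub_mixedDeepBound` (mixed compression class), case
`p = 1`, left generator on row `0`, `q` ARBITRARY constant right generators `w_1, …, w_q`
(registered special case `mixedDeepBound_p_one_row0`, file `…MixedRow0General`: `r ≤ q + 2`).

Model `ℂ^N = ℂ[X]/(X^N)`: a column `e` is `∑ e_n X^n`, `Zᵀ` is "divide by `X`", and the *tail* of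
`e` against a constant vector `v` is the correlation polynomial
`κ(v,e) = ∑_k ⟪v, (Zᵀ)^k e⟫ X^k = ∑_i v_i · (e /ₘ X^i)`.  A coefficient matrix
of the class maps `e ↦ c · κ(η,e) + ∑_l γ_l · κ(w_l,e) (mod X^N)` (`c` scalar, `γ_l`, `η` free).
* `hclR_tail_lowdeg(_corr)` — TAILS OF A SYZYGY ARE SHORT: `deg P_c ≤ μ`, `∑_c P_c e_c = 0` ⇒
  `∑_c P_c (e_c /ₘ X^i)` and `∑_c P_c κ(v, e_c)` have no coefficient in degrees `≥ μ`.
* `hclR_tail_slot_poly` — SLOT LEMMA: `q + 3` slots `b, c` with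
  `c_b κ(η_b, e_c) + ∑_l γ_{bl} κ(w_l, e_c) ≡ [b = c] φ (mod X^N)` force `φ = 0`.  The short-syzygy
  argument of `hclR_blockToeplitz_slot` run with TAIL SYZYGIES (`∑_c P_c e_c = 0` and
  `∑_c P_c κ(w_l, e_c) = 0` for all `l`): (A) a tail syzygy of degree `≤ μ` kills the coefficients
  of `P_b φ` in `[μ, N)`; (B) one of degree `≤ m := N/2` exists by counting, `(q+3)(m+1)` unknowns
  against `N + m` equations for the frame plus only `m` per generator (generator tails of a frame
  syzygy are automatically short); (C)/(D) minimal degree, truncations `P_b φ mod X^N`, valuation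
  of `φ` as in the block-Toeplitz case.  Pure polynomial algebra; nothing beyond Mathlib.  The
  coordinate form (vectors, the Stein toolkit's correlation sums) is in `…MixedRow0General`.
-/

-- D-0017: the single-problem layout `Summits/<S>/<S>/…` duplicates a namespace segment by design.
set_option linter.dupNamespace false

namespace Summit.MatrixMultiplication.MatrixMultiplication.Theorems

open Polynomial Matrix BigOperators Finset

/-- Dividing by `X ^ m` shifts the coefficients down by `m`. -/
theorem hclR_tail_coeff_divByMonic_X_pow (p : ℂ[X]) (m k : ℕ) :
    (p /ₘ X ^ m).coeff k = p.coeff (k + m) := by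
  have h := modByMonic_add_div p (X ^ m)
  have h1 : (p %ₘ X ^ m).coeff (k + m) = 0 := by
    apply coeff_eq_zero_of_degree_lt
    calc (p %ₘ X ^ m).degree < ((X : ℂ[X]) ^ m).degree := degree_modByMonic_lt _ (monic_X_pow m)
      _ = m := degree_X_pow m
      _ ≤ (k + m : ℕ) := by exact_mod_cast Nat.le_add_left m k
  have h2 := congrArg (fun r : ℂ[X] => r.coeff (k + m)) h
  rw [coeff_add, h1, zero_add, coeff_X_pow_mul] at h2
  exact h2

/-- **Tails of a syzygy are short.**  If `deg P_c ≤ μ` and `∑_c P_c e_c = 0`, then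
`∑_c P_c · (e_c /ₘ X^m)` has no coefficient in degrees `≥ μ`: multiplying by `X^m` turns it into
`-∑_c P_c · (e_c mod X^m)`, of degree `< μ + m`. -/
theorem hclR_tail_lowdeg {ι : Type*} [Fintype ι] (μ m : ℕ) (P e : ι → ℂ[X])
    (hP : ∀ c, (P c).natDegree ≤ μ) (hsyz : ∑ c, P c * e c = 0) (K : ℕ) (hK : μ ≤ K) :
    (∑ c, P c * (e c /ₘ X ^ m)).coeff K = 0 := by
  have hdec : ∀ c, e c %ₘ X ^ m + X ^ m * (e c /ₘ X ^ m) = e c :=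
    fun c => modByMonic_add_div (e c) (X ^ m)
  have key : X ^ m * ∑ c, P c * (e c /ₘ X ^ m) + ∑ c, P c * (e c %ₘ X ^ m) = ∑ c, P c * e c := by
    rw [Finset.mul_sum, ← Finset.sum_add_distrib]
    refine Finset.sum_congr rfl fun c _ => ?_
    conv_rhs => rw [← hdec c]
    ring
  rw [hsyz] at key
  rw [← coeff_X_pow_mul _ m K, eq_neg_of_add_eq_zero_left key, coeff_neg, neg_eq_zero,
    finsetSum_coeff]
  refine Finset.sum_eq_zero fun c _ => ?_
  by_cases hr : e c %ₘ X ^ m = 0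
  · rw [hr, mul_zero, coeff_zero]
  apply coeff_eq_zero_of_natDegree_lt
  have hdeg : (e c %ₘ X ^ m).natDegree < m := by
    rw [natDegree_lt_iff_degree_lt hr]
    calc (e c %ₘ X ^ m).degree < ((X : ℂ[X]) ^ m).degree := degree_modByMonic_lt _ (monic_X_pow m)
      _ = m := degree_X_pow m
  calc (P c * (e c %ₘ X ^ m)).natDegree ≤ (P c).natDegree + (e c %ₘ X ^ m).natDegree :=
      natDegree_mul_le
    _ < K + m := by have := hP c; omega

/-- Tails against any constant vector `v` of a syzygy of degree `≤ μ` are short: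
`∑_c P_c κ(v, e_c)` has no coefficient in degrees `≥ μ`. -/
theorem hclR_tail_lowdeg_corr {ι : Type*} [Fintype ι] {N : ℕ} (μ : ℕ) (v : Fin N → ℂ)
    (P e : ι → ℂ[X]) (hP : ∀ c, (P c).natDegree ≤ μ) (hsyz : ∑ c, P c * e c = 0)
    (K : ℕ) (hK : μ ≤ K) :
    (∑ c, P c * ∑ i : Fin N, C (v i) * (e c /ₘ X ^ (i : ℕ))).coeff K = 0 := by
  have e1 : ∑ c, P c * ∑ i : Fin N, C (v i) * (e c /ₘ X ^ (i : ℕ)) =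
      ∑ i : Fin N, C (v i) * ∑ c, P c * (e c /ₘ X ^ (i : ℕ)) := by
    simp only [Finset.mul_sum]
    rw [Finset.sum_comm]
    exact Finset.sum_congr rfl fun i _ => Finset.sum_congr rfl fun c _ => by ring
  rw [e1, finsetSum_coeff]
  exact Finset.sum_eq_zero fun i _ => by
    rw [coeff_C_mul, hclR_tail_lowdeg μ i P e hP hsyz K hK, mul_zero]

/-- **Slot lemma for the row-`0` mixed class with general right generators (polynomial form).**
Let `w_1, …, w_q` be constant vectors, and for `q + 3` slots `b` let `η_b` be vectors, `c_b`
scalars and `γ_{b l}` polynomials.  If the column polynomials `e_c` (`deg < N`) and the target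
`φ` (`deg < N`) satisfy `c_b κ(η_b, e_c) + ∑_l γ_{b l} κ(w_l, e_c) ≡ [b = c] φ (mod X^N)` for all
slots `b, c`, where `κ(v, e) = ∑_i v_i (e /ₘ X^i)`, then `φ = 0`.  Short tail syzygies, see the
file header: (A) orthogonality, (B) existence in degree `≤ N/2` by counting, (C) truncations,
(D) valuation of `φ`. -/
theorem hclR_tail_slot_poly :
    ∀ (N q : ℕ) (w : Fin q → Fin N → ℂ) (η : Fin (q + 3) → Fin N → ℂ) (cst : Fin (q + 3) → ℂ)
      (γ : Fin (q + 3) → Fin q → Polynomial ℂ) (e : Fin (q + 3) → Polynomial ℂ) (φ : Polynomial ℂ),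
      (∀ (c : Fin (q + 3)) (k : ℕ), N ≤ k → (e c).coeff k = 0) → (∀ k : ℕ, N ≤ k → φ.coeff k = 0) →
      (∀ b c : Fin (q + 3), (Polynomial.X : Polynomial ℂ) ^ N ∣
        Polynomial.C (cst b) * (∑ i : Fin N, Polynomial.C (η b i) * (e c /ₘ Polynomial.X ^ (i : ℕ))) +
          (∑ l : Fin q, γ b l * ∑ i : Fin N, Polynomial.C (w l i) * (e c /ₘ Polynomial.X ^ (i : ℕ))) -
          (if b = c then φ else 0)) →
      φ = 0 := by
  intro N q w η cst γ e φ he hφ hslot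
  classical
  by_contra hφ0
  have hN : 0 < N :=
    Nat.pos_of_ne_zero fun h => hφ0 (Polynomial.ext fun k => by rw [hφ k (by omega), coeff_zero])
  -- tails of the frame against the right generators
  obtain ⟨κ, hκ⟩ : ∃ κ : Fin q → Fin (q + 3) → ℂ[X],
      ∀ l c, κ l c = ∑ i : Fin N, C (w l i) * (e c /ₘ X ^ (i : ℕ)) := ⟨_, fun _ _ => rfl⟩
  simp only [← hκ] at hslot
  have hdegN : ∀ p : ℂ[X], (∀ k, N ≤ k → p.coeff k = 0) → p ≠ 0 → p.natDegree < N := by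
    intro p hp hz
    by_contra h
    have := hp _ (not_lt.mp h)
    rw [coeff_natDegree, leadingCoeff_eq_zero] at this
    exact hz this
  have he_deg : ∀ c, e c ≠ 0 → (e c).natDegree < N := fun c => hdegN (e c) (he c)
  have hφ_deg : φ.natDegree < N := hdegN φ hφ hφ0
  -- two closure properties of relations `∑_c A_c F_c = 0`
  have hprop : ∀ (A B F : Fin (q + 3) → ℂ[X]) (b₀ : Fin (q + 3)), A b₀ ≠ 0 →
      (∀ b c, A c * B b = A b * B c) → ∑ c, A c * F c = 0 → ∑ c, B c * F c = 0 := by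
    intro A B F b₀ hb₀ hcross hA
    have h1 : A b₀ * ∑ c, B c * F c = B b₀ * ∑ c, A c * F c := by
      rw [Finset.mul_sum, Finset.mul_sum]
      refine Finset.sum_congr rfl fun c _ => ?_
      rw [← mul_assoc, ← mul_assoc, hcross c b₀, mul_comm (A c)]
    rw [hA, mul_zero] at h1
    exact (mul_eq_zero.mp h1).resolve_left hb₀
  have hdivp : ∀ (A B F : Fin (q + 3) → ℂ[X]) (n : ℕ), (∀ c, A c = X ^ n * B c) →
      ∑ c, A c * F c = 0 → ∑ c, B c * F c = 0 := by
    intro A B F n hAB hA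
    have h1 : (X : ℂ[X]) ^ n * ∑ c, B c * F c = ∑ c, A c * F c := by
      rw [Finset.mul_sum]
      exact Finset.sum_congr rfl fun c _ => by rw [← mul_assoc, ← hAB c]
    rw [hA] at h1
    exact (mul_eq_zero.mp h1).resolve_left (pow_ne_zero _ X_ne_zero)
  -- tail syzygies
  let Syz : (Fin (q + 3) → ℂ[X]) → Prop := fun P =>
    ∑ c, P c * e c = 0 ∧ ∀ l, ∑ c, P c * κ l c = 0
  -- (A) orthogonality: coefficients of `P b * φ` vanish in degrees `[μ, N)`
  have horth : ∀ (P : Fin (q + 3) → ℂ[X]) (μ : ℕ), Syz P → (∀ c, (P c).natDegree ≤ μ) →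
      ∀ b, ∀ K, μ ≤ K → K < N → (P b * φ).coeff K = 0 := by
    intro P μ hP hdeg b K hμK hKN
    choose y hy using fun c => exists_eq_mul_right_of_dvd (hslot b c)
    -- sum the slot identities of row `b` against `P`
    have hA : ∑ c, P c * (C (cst b) * ∑ i : Fin N, C (η b i) * (e c /ₘ X ^ (i : ℕ))) =
        C (cst b) * ∑ c, P c * ∑ i : Fin N, C (η b i) * (e c /ₘ X ^ (i : ℕ)) := by
      rw [Finset.mul_sum]
      exact Finset.sum_congr rfl fun c _ => by ring
    have hB : ∑ c, P c * ∑ l, γ b l * κ l c = 0 := by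
      calc ∑ c, P c * ∑ l, γ b l * κ l c = ∑ l, γ b l * ∑ c, P c * κ l c := by
            simp only [Finset.mul_sum]
            rw [Finset.sum_comm]
            exact Finset.sum_congr rfl fun l _ => Finset.sum_congr rfl fun c _ => by ring
        _ = 0 := Finset.sum_eq_zero fun l _ => by rw [hP.2 l, mul_zero]
    have hD : ∑ c, P c * (if b = c then φ else 0) = P b * φ := by
      rw [Finset.sum_eq_single b, if_pos rfl]
      · intro c _ hcb
        rw [if_neg (Ne.symm hcb), mul_zero]
      · simp
    have h1 : ∑ c, P c * (C (cst b) * (∑ i : Fin N, C (η b i) * (e c /ₘ X ^ (i : ℕ))) +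
        (∑ l, γ b l * κ l c) - (if b = c then φ else 0)) = X ^ N * ∑ c, P c * y c := by
      rw [Finset.mul_sum]
      refine Finset.sum_congr rfl fun c _ => ?_
      rw [hy c, mul_left_comm]
    simp only [mul_sub, mul_add, Finset.sum_sub_distrib, Finset.sum_add_distrib, hA, hB, hD,
      add_zero] at h1
    have h2 := congrArg (fun p : ℂ[X] => p.coeff K) h1
    simp only [coeff_sub, coeff_C_mul, hclR_tail_lowdeg_corr μ (η b) P e hdeg hP.1 K hμK,
      mul_zero, zero_sub, coeff_X_pow_mul', if_neg (not_le.mpr hKN), neg_eq_zero] at h2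
    exact h2
  -- (B) a nonzero tail syzygy of degree ≤ m := N / 2 exists (dimension count)
  set m := N / 2 with hm
  have hexist : ∃ P : Fin (q + 3) → ℂ[X], Syz P ∧ P ≠ 0 ∧ ∀ c, (P c).natDegree ≤ m := by
    let vfam : Fin (q + 3) × Fin (m + 1) → (Fin (N + m) ⊕ (Fin q × Fin m) → ℂ) := fun ca =>
      Sum.elim (fun k => (X ^ (ca.2 : ℕ) * e ca.1).coeff k)
        (fun lk => (X ^ (ca.2 : ℕ) * κ lk.1 ca.1).coeff lk.2)
    have hli : ¬ LinearIndependent ℂ vfam := by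
      intro hli
      have h1 := hli.fintype_card_le_finrank
      rw [Module.finrank_fintype_fun_eq_card] at h1
      simp only [Fintype.card_prod, Fintype.card_sum, Fintype.card_fin] at h1
      have e1 : (q + 3) * (m + 1) = q * m + (q + 3 * m + 3) := by ring
      rw [e1] at h1
      omega
    obtain ⟨g, hg, ⟨c₀, a₀⟩, hg0⟩ := Fintype.not_linearIndependent_iff.mp hli
    have hPdeg : ∀ c, (∑ a : Fin (m + 1), C (g (c, a)) * X ^ (a : ℕ)).natDegree ≤ m := fun c =>
      natDegree_sum_le_of_forall_le _ _ fun a _ => (natDegree_C_mul_X_pow_le _ _).trans (by omega)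
    have hcoef : ∀ (F : Fin (q + 3) → ℂ[X]) (k : ℕ),
        (∑ c, (∑ a : Fin (m + 1), C (g (c, a)) * X ^ (a : ℕ)) * F c).coeff k =
          ∑ c, ∑ a : Fin (m + 1), g (c, a) * (X ^ (a : ℕ) * F c).coeff k := by
      intro F k
      rw [finsetSum_coeff]
      refine Finset.sum_congr rfl fun c _ => ?_
      rw [Finset.sum_mul, finsetSum_coeff]
      refine Finset.sum_congr rfl fun a _ => ?_
      rw [mul_assoc, coeff_C_mul]
    have hsyz_e : ∑ c, (∑ a : Fin (m + 1), C (g (c, a)) * X ^ (a : ℕ)) * e c = 0 := by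
      ext k
      rw [coeff_zero]
      by_cases hk : k < N + m
      · have h1 := congr_fun hg (Sum.inl ⟨k, hk⟩)
        simp only [vfam, Finset.sum_apply, Pi.smul_apply, smul_eq_mul, Pi.zero_apply,
          Sum.elim_inl] at h1
        rw [Fintype.sum_prod_type] at h1
        rw [hcoef]
        exact h1
      · rw [finsetSum_coeff]
        refine Finset.sum_eq_zero fun c _ => ?_
        by_cases hz : e c = 0
        · rw [hz, mul_zero, coeff_zero]
        apply coeff_eq_zero_of_natDegree_lt
        calc ((∑ a : Fin (m + 1), C (g (c, a)) * X ^ (a : ℕ)) * e c).natDegree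
            ≤ (∑ a : Fin (m + 1), C (g (c, a)) * X ^ (a : ℕ)).natDegree + (e c).natDegree :=
              natDegree_mul_le
          _ < k := by have := hPdeg c; have := he_deg c hz; omega
    refine ⟨fun c => ∑ a : Fin (m + 1), C (g (c, a)) * X ^ (a : ℕ), ⟨hsyz_e, fun l => ?_⟩, ?_, hPdeg⟩
    · show ∑ c, (∑ a : Fin (m + 1), C (g (c, a)) * X ^ (a : ℕ)) * κ l c = 0
      ext k
      rw [coeff_zero]
      by_cases hk : k < m
      · have h1 := congr_fun hg (Sum.inr (l, ⟨k, hk⟩))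
        simp only [vfam, Finset.sum_apply, Pi.smul_apply, smul_eq_mul, Pi.zero_apply,
          Sum.elim_inr] at h1
        rw [Fintype.sum_prod_type] at h1
        rw [hcoef]
        exact h1
      · push Not at hk
        have h1 := hclR_tail_lowdeg_corr m (w l) _ e hPdeg hsyz_e k hk
        simpa only [hκ] using h1
    · intro hP
      apply hg0
      have h1 : (∑ a : Fin (m + 1), C (g (c₀, a)) * X ^ (a : ℕ)) = 0 := congr_fun hP c₀
      have hc := congrArg (fun p : ℂ[X] => p.coeff a₀) h1
      simp only [finsetSum_coeff, coeff_C_mul_X_pow, coeff_zero] at hc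
      rw [Finset.sum_eq_single a₀] at hc
      · simpa using hc
      · intro a _ ha
        rw [if_neg]
        exact fun h => ha (Fin.ext (by omega))
      · simp
  -- minimal degree `μ` of a nonzero tail syzygy
  let Pred : ℕ → Prop := fun μ => ∃ P : Fin (q + 3) → ℂ[X], Syz P ∧ P ≠ 0 ∧ ∀ c, (P c).natDegree ≤ μ
  have hPred : ∃ μ, Pred μ := ⟨m, hexist⟩
  obtain ⟨P, hPsyz, hP0, hPdeg⟩ : Pred (Nat.find hPred) := Nat.find_spec hPred
  set μ := Nat.find hPred with hμdef
  have hμm : μ ≤ m := Nat.find_min' hPred hexist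
  have hmin : ∀ Q : Fin (q + 3) → ℂ[X], Syz Q → (∀ c, Q c ≠ 0 → (Q c).natDegree < μ) → Q = 0 := by
    intro Q hQ hQdeg
    by_contra hQ0
    obtain ⟨c₁, hc₁⟩ : ∃ c, Q c ≠ 0 := by
      by_contra hall; push Not at hall; exact hQ0 (funext hall)
    have hμpos : 0 < μ := by have := hQdeg c₁ hc₁; omega
    have hP' : Pred (μ - 1) := ⟨Q, hQ, hQ0, fun c => by
      by_cases h : Q c = 0
      · rw [h, natDegree_zero]; exact Nat.zero_le _
      · have := hQdeg c h; omega⟩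
    exact Nat.find_min hPred (show μ - 1 < μ by omega) hP'
  have h2μ : 2 * μ ≤ N := by omega
  -- (C) truncations `ρ b := (P b * φ) mod X^N` have degree `< μ`
  have hXN : (X ^ N : ℂ[X]).Monic := monic_X_pow N
  have hdiv : ∀ b, ∃ ρb σb : ℂ[X], P b * φ = ρb + X ^ N * σb ∧ ρb.degree < N := fun b =>
    ⟨(P b * φ) %ₘ X ^ N, (P b * φ) /ₘ X ^ N, (modByMonic_add_div (P b * φ) (X ^ N)).symm,
      (degree_modByMonic_lt _ hXN).trans_eq (degree_X_pow N)⟩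
  choose ρ σ hρσ hρN using hdiv
  have hρcoeff : ∀ b K, μ ≤ K → (ρ b).coeff K = 0 := by
    intro b K hK
    rcases lt_or_ge K N with hKN | hKN
    · have e1 : (ρ b).coeff K = (P b * φ).coeff K - (X ^ N * σ b).coeff K := by
        rw [hρσ b, coeff_add]; ring
      rw [e1, horth P μ hPsyz hPdeg b K hK hKN, coeff_X_pow_mul', if_neg (by omega), sub_zero]
    · apply coeff_eq_zero_of_degree_lt
      calc (ρ b).degree < N := hρN b
        _ ≤ K := by exact_mod_cast hKN
  have hρdeg : ∀ b, ρ b ≠ 0 → (ρ b).natDegree < μ := by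
    intro b hb
    by_contra h
    push Not at h
    have := hρcoeff b _ h
    rw [coeff_natDegree, leadingCoeff_eq_zero] at this
    exact hb this
  -- cross relation `P c * ρ b = P b * ρ c`
  have hcross : ∀ b c, P c * ρ b = P b * ρ c := by
    intro b c
    have hdvd : (X ^ N : ℂ[X]) ∣ (P c * ρ b - P b * ρ c) := by
      refine ⟨P b * σ c - P c * σ b, ?_⟩
      have eb := hρσ b
      have ec := hρσ c
      linear_combination (P b) * ec - (P c) * eb
    have h1 : ∀ b c, (P c * ρ b).natDegree < N := by
      intro b c
      by_cases hb : ρ b = 0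
      · rw [hb, mul_zero, natDegree_zero]; exact hN
      · calc (P c * ρ b).natDegree ≤ (P c).natDegree + (ρ b).natDegree := natDegree_mul_le
          _ < N := by have := hPdeg c; have := hρdeg b hb; omega
    have hdeg : (P c * ρ b - P b * ρ c).natDegree < (X ^ N : ℂ[X]).natDegree := by
      rw [natDegree_X_pow]
      calc (P c * ρ b - P b * ρ c).natDegree
          ≤ max (P c * ρ b).natDegree (P b * ρ c).natDegree := natDegree_sub_le _ _
        _ < N := max_lt (h1 b c) (h1 c b)
    exact sub_eq_zero.mp (eq_zero_of_dvd_of_natDegree_lt hdvd hdeg)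
  -- `ρ` is a tail syzygy of degree `< μ`, hence zero
  obtain ⟨b₀, hb₀⟩ : ∃ b, P b ≠ 0 := by
    by_contra hall; push Not at hall; exact hP0 (funext hall)
  have hρsyz : Syz ρ :=
    ⟨hprop P ρ e b₀ hb₀ hcross hPsyz.1, fun l => hprop P ρ (κ l) b₀ hb₀ hcross (hPsyz.2 l)⟩
  have hρ0 : ρ = 0 := hmin ρ hρsyz fun c hc => hρdeg c hc
  have hdvdN : ∀ b, (X ^ N : ℂ[X]) ∣ P b * φ := by
    intro b
    refine ⟨σ b, ?_⟩
    have h1 := hρσ b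
    rw [show ρ b = 0 from congr_fun hρ0 b, zero_add] at h1
    exact h1
  -- (D) valuation of `φ`: `φ = X^ν * u`, `X ∤ u`, `ν < N`
  obtain ⟨u, hu, hXu⟩ := exists_eq_pow_rootMultiplicity_mul_and_not_dvd φ hφ0 0
  rw [map_zero, sub_zero] at hu hXu
  set ν := rootMultiplicity 0 φ with hν
  have hνN : ν < N := by
    have h1 : (X ^ ν : ℂ[X]) ∣ φ := ⟨u, hu⟩
    have h2 := natDegree_le_of_dvd h1 hφ0
    rw [natDegree_X_pow] at h2
    omega
  have hcop : IsCoprime ((X : ℂ[X]) ^ (N - ν)) u :=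
    ((irreducible_X.coprime_iff_not_dvd).mpr hXu).pow_left
  have hdvdP : ∀ b, ∃ Qb : ℂ[X], P b = X ^ (N - ν) * Qb := by
    intro b
    apply hcop.dvd_of_dvd_mul_right
    have h := hdvdN b
    rw [hu, ← mul_assoc, mul_comm (P b), mul_assoc,
      show (X ^ N : ℂ[X]) = X ^ ν * X ^ (N - ν) by rw [← pow_add]; congr 1; omega] at h
    exact (mul_dvd_mul_iff_left (pow_ne_zero ν X_ne_zero)).mp h
  choose Q hQ using hdvdP
  have hQsyz : Syz Q :=
    ⟨hdivp P Q e (N - ν) hQ hPsyz.1, fun l => hdivp P Q (κ l) (N - ν) hQ (hPsyz.2 l)⟩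
  have hQ0 : Q = 0 := hmin Q hQsyz fun c hc => by
    have h1 : (P c).natDegree = (N - ν) + (Q c).natDegree := by
      rw [hQ c, natDegree_mul (pow_ne_zero _ X_ne_zero) hc, natDegree_X_pow]
    have := hPdeg c
    omega
  apply hP0
  funext c
  rw [hQ c, show Q c = 0 from congr_fun hQ0 c, mul_zero]
  rfl

end Summit.MatrixMultiplication.MatrixMultiplication.Theorems
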